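import Summits.BirchSwinnertonDyer.BirchSwinnertonDyer.Theorems.Rank1ResidualJetKolyvaginClassSign
import Summits.BirchSwinnertonDyer.Rank1Residual.JET.GrossProp53Kolyvagin
import Literature.NumberTheory.EllipticCurves.HeegnerPointsOfConductorRationalityProofs
import Literature.NumberTheory.EllipticCurves.RingClassGalOverCyclicProofs
import HarnessLib

/-!
# T1 JET (cell `bsd-jet`), road K: the SIGN of the concrete Kolyvagin class under complex conjugation,
# `τ_* c_k(c) = −w(E)·(−1)^{#primes of c} · c_k(c)` (Gross 1991 Prop. 5.4 (1)) — UNCONDITIONAL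

HONEST FRAMING (programme file §HONESTY, verbatim): «no tranche here proves BSD; ARM L moves the
LITERAL column of an r ≤ 1 census into the kernel-proved-modulo-named-print column.» THEOREMS ONLY
(seat `bsd-jet-read-1`, reader 1, session g10; node `Rank1Residual/JET`); 0 classes move; no named fact,
no `sorry`.

WHAT THIS IS. pv-2's `JET.exists_sign_conjAct_kolyvaginClass_of_prop53`
(`Theorems/Rank1ResidualJetKolyvaginClassSign.lean` :268–311, p498178) gives the `hκsign` input of the H63
line — `τ_* c_k(c) = e·c_k(c)`, `e = ε·(−1)^{#primes of c}` — MODULO three named inputs: the two Gross §3 CM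
facts `hCM1`/`hCM2` (since discharged: `phi_heegnerPointOfConductor_mem_range_map_ringClassField_holds`,
`exists_generator_ringClassGalOver_holds`) and the cite-only schema `h53` «Gross Prop. 5.3 at every
conductor `m` and datum, for the sign `ε`» — which the H63 line (`…Thm63KernelInputs` :248, :282), its
primed twin, `…_of_localFacts'` and the three END FORMs thread as a hypothesis, universally closed over
ALL `m` (a schema stronger than print and not derivable as closed: reader 1 ADD-9 ANNEX-2/3).  Prop. 5.3
is now a theorem BY NAME at every conductor `m ≠ 0` prime to `N`
(`JET.exists_mem_ringClassGal_isOfFinAddOrder_conj_sub_smul`, file `GrossProp53Kolyvagin.lean`, p525846 =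
x11b3 `X11b.KolyvaginA53.h53_of_recM` ∘ Literature
`exists_mem_ringClassGal_map_pointGalHom_y_eq_of_heegnerHypothesis`), and pv-2's proof applies `h53` only
at the divisors of the Kolyvagin conductor `c` (all `≠ 0` and prime to `N`).  So the sign statement holds
with NO named input, `ε = −w(E)`:

* `sign_conjAct_kolyvaginClass` — EXACTLY the output shape of
  `exists_sign_conjAct_kolyvaginClass_of_prop53` with `ε := −W.rootNumber` (so the consumer's swap at
  `…Thm63KernelInputs` :248/:282 is `exists_sign_conjAct_kolyvaginClass_of_prop53 hCM1 hCM2 hK hD3 hD4 hH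
  hp2 hρ τ hτ Dt β ι ε hε h53` ↦ `sign_conjAct_kolyvaginClass hK hD3 hD4 hH hp2 hρ τ hτ Dt β ι`, after
  which the binders `ε`, `hε`, `h53` can be deleted up the chain and from the END FORMs — row 9 of the
  road-K named-print ledger then LEAVES the hypotheses);
* `exists_sign_conjAct_kolyvaginClass` — the `∃ e ∈ {±1}` form.

Proof = pv-2's 25-line assembly verbatim (data at every divisor of `c` from the CM theorems, admissibility
`RingClassNoTorsion.isAdmissible_pointsSubgroup`, then `conjAct_kolyvaginClass_eq_sign_smul_zhang`), with
the per-divisor Prop. 5.3 supplied by `exists_mem_ringClassGal_isOfFinAddOrder_conj_sub_smul`.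
References: [cite: GrossLMS1991, §5 (5.2), Prop. 5.3, Prop. 5.4 (1) (p. 243)] [cite: Jetchev2008, §4.1.3
(ε(c)), proof of Thm. 5.2 (p. 822)] [cite: WZhang2014, Notations (xii)].
-/

set_option autoImplicit false

noncomputable section

open scoped Classical
open WeierstrassCurve Field NumberField IsDedekindDomain Finset
open Literature.NumberTheory.EllipticCurves Literature.NumberTheory.GaloisRepresentations
open Literature.NumberTheory.EllipticCurves.KolyvaginCocycle Literature.NumberTheory.EllipticCurves.KolyvaginEuler
open Literature.NumberTheory.EllipticCurves.RingClassField Literature.NumberTheory.EllipticCurves.ModularForms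
open Summit.BirchSwinnertonDyer.Rank1Residual.X11b Summit.BirchSwinnertonDyer.Rank1Residual.X11b.Three
open Summit.BirchSwinnertonDyer.Rank1Residual.X11b.KolyvaginTauEigen

namespace Summit.BirchSwinnertonDyer.Rank1Residual.JET

variable {K : Type} [Field K] [NumberField K] {W : WeierstrassCurve ℚ}

/-- **Gross 1991 Prop. 5.4 (1) for the concrete class, UNCONDITIONAL**: for `E/ℚ` globally minimal with
`ρ̄_{E,p}` onto at an odd `p`, `K` imaginary quadratic with `d_K ∉ {−3, −4}` and the Heegner hypothesis
for `N = N_E`, the non-trivial `τ ∈ Aut(K/ℚ)`, a frame `(Dt, β, ι)`, a square-free conductor `c` all of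
whose prime factors are Kolyvagin primes of index `≥ k ≥ 1`, and ANY datum `d` of conductor `c`:
`τ_* c_k(c) = e • c_k(c)` with `e = −w(E)·(−1)^{#primes of c} ∈ {±1}` — the output of
`exists_sign_conjAct_kolyvaginClass_of_prop53` at `ε = −w(E)` with its three named inputs discharged
(`…_holds` ×2, Prop. 5.3 by `exists_mem_ringClassGal_isOfFinAddOrder_conj_sub_smul` at every divisor of `c`).
[cite: GrossLMS1991, §5 Prop. 5.3, Prop. 5.4 (1) (p. 243)] [cite: Jetchev2008, §4.1.3 (ε(c))] -/
theorem sign_conjAct_kolyvaginClass [W.IsElliptic] [W.IsGloballyMinimal] [NeZero (W.conductorNorm ℤ)]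
    (hK : IsImaginaryQuadratic K) (hD3 : NumberField.discr K ≠ -3) (hD4 : NumberField.discr K ≠ -4)
    (hH : SatisfiesHeegnerHypothesis (W.conductorNorm ℤ) K)
    {p : ℕ} [Fact p.Prime] (hp2 : p ≠ 2) (hρ : W.HasSurjectiveModNGaloisRep p)
    (τ : K ≃ₐ[ℚ] K) (hτ : τ ≠ 1)
    (Dt : ModularParametrizationData W (W.conductorNorm ℤ)) (β : ℤ) (ι : K →+* ℂ)
    {c : ℕ} (hc : Squarefree c) {k : ℕ} (hk : 1 ≤ k)
    (hcK : ∀ ℓ ∈ c.primeFactors, Zhang2014.IsKolyvaginPrime (W.conductorNorm ℤ) W K p ℓ ∧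
      k ≤ Zhang2014.kolyvaginIndex W p ℓ)
    (d : KolyvaginHeegnerData Dt β ι c) :
    (-W.rootNumber * (-1) ^ c.primeFactors.card = 1 ∨ -W.rootNumber * (-1) ^ c.primeFactors.card = -1) ∧
      conjAct W τ ((p ^ k : ℕ) : ℤ) (d.kolyvaginClass (Fact.out : p.Prime) k) =
        (-W.rootNumber * (-1) ^ c.primeFactors.card) • d.kolyvaginClass (Fact.out : p.Prime) k := by
  have hp : p.Prime := Fact.out
  have hCM1 : phi_heegnerPointOfConductor_mem_range_map_ringClassField (W.conductorNorm ℤ) W K :=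
    phi_heegnerPointOfConductor_mem_range_map_ringClassField_holds (W.conductorNorm ℤ) W K
  have hCM2 : exists_generator_ringClassGalOver K := exists_generator_ringClassGalOver_holds
  have hND : IsCoprime (W.conductorNorm ℤ : ℤ) (NumberField.discr K) :=
    KolyvaginAssembly.isCoprime_discr_of_satisfiesHeegnerHypothesis hK hH
  have hD : NumberField.discr K < -4 := KolyvaginAssembly.discr_lt_neg_four hK ⟨hD3, hD4⟩
  have hinert : ∀ (m' : ℕ), m' ∣ c → ∀ q ∈ m'.primeFactors, (Ideal.span {(q : 𝓞 K)}).IsPrime :=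
    fun m' hm' q hq ↦ (hcK q (Nat.primeFactors_mono hm' hc.ne_zero hq)).1.2.2.2.2.1
  -- data at every divisor of `c` (the given `d` at `c` itself)
  have hne : ∀ m' : ℕ, m' ∣ c → Nonempty (KolyvaginHeegnerData Dt β ι m') := fun m' hm' ↦
    BirchSwinnertonDyer.Theorems.nonempty_kolyvaginHeegnerData_of_grossCM hCM1 hCM2 hK hH Dt β ι
      d.dvd_sq_sub (hc.squarefree_of_dvd hm') (hinert m' hm')
  let data : (m' : ℕ) → m' ∣ c → KolyvaginHeegnerData Dt β ι m' := fun m' hm' ↦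
    if h : m' = c then h ▸ d else (hne m' hm').some
  have hdata : data c dvd_rfl = d := by simp [data]
  -- Gross Prop. 5.3 at every divisor of `c` (all `≠ 0` and prime to `N`), UNCONDITIONALLY
  have h53 : ∀ (m : ℕ) (hm : m ∣ c) (τm : ringClassField K ι m ≃ₐ[ℚ] ringClassField K ι m),
      (∀ x : ringClassField K ι m, ((τm x : ringClassField K ι m) : ℂ) = starRingEnd ℂ x) →
      ∃ σ' ∈ ringClassGal ι m, IsOfFinAddOrder
        (pointGalHom W (ringClassField K ι m) τm (data m hm).y -
          (-W.rootNumber) • pointGalHom W (ringClassField K ι m) σ' (data m hm).y) := by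
    intro m hm τm hτm
    obtain ⟨hm0, hmN⟩ := ne_zero_and_coprime_of_isKolyvaginPrime (K := K) (hc.squarefree_of_dvd hm)
      (fun q hq ↦ (hcK q (Nat.primeFactors_mono hm hc.ne_zero hq)).1)
    exact exists_mem_ringClassGal_isOfFinAddOrder_conj_sub_smul W hK hH Dt ι hm0 hmN (data m hm) τm hτm
  refine ⟨?_, ?_⟩
  · rcases W.rootNumber_eq_one_or with h1 | h1 <;>
      rcases neg_one_pow_eq_or ℤ c.primeFactors.card with h | h <;> simp [h1, h]
  · have h := conjAct_kolyvaginClass_eq_sign_smul_zhang (c := τ) hK ι hp hk Dt hND hD hc hcK data hτ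
      (-W.rootNumber) h53
      (fun m hm ↦ RingClassNoTorsion.isAdmissible_pointsSubgroup _ hK
        (ne_zero_of_dvd_ne_zero hc.ne_zero hm) hp hp2 hρ k) c dvd_rfl
    rwa [hdata] at h

/-- The same in the `∃ e ∈ {±1}` form. [cite: GrossLMS1991, §5 Prop. 5.4 (1) (p. 243)] -/
theorem exists_sign_conjAct_kolyvaginClass [W.IsElliptic] [W.IsGloballyMinimal]
    [NeZero (W.conductorNorm ℤ)]
    (hK : IsImaginaryQuadratic K) (hD3 : NumberField.discr K ≠ -3) (hD4 : NumberField.discr K ≠ -4)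
    (hH : SatisfiesHeegnerHypothesis (W.conductorNorm ℤ) K)
    {p : ℕ} [Fact p.Prime] (hp2 : p ≠ 2) (hρ : W.HasSurjectiveModNGaloisRep p)
    (τ : K ≃ₐ[ℚ] K) (hτ : τ ≠ 1)
    (Dt : ModularParametrizationData W (W.conductorNorm ℤ)) (β : ℤ) (ι : K →+* ℂ)
    {c : ℕ} (hc : Squarefree c) {k : ℕ} (hk : 1 ≤ k)
    (hcK : ∀ ℓ ∈ c.primeFactors, Zhang2014.IsKolyvaginPrime (W.conductorNorm ℤ) W K p ℓ ∧
      k ≤ Zhang2014.kolyvaginIndex W p ℓ)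
    (d : KolyvaginHeegnerData Dt β ι c) :
    ∃ e : ℤ, (e = 1 ∨ e = -1) ∧
      conjAct W τ ((p ^ k : ℕ) : ℤ) (d.kolyvaginClass (Fact.out : p.Prime) k) =
        e • d.kolyvaginClass (Fact.out : p.Prime) k :=
  ⟨_, sign_conjAct_kolyvaginClass hK hD3 hD4 hH hp2 hρ τ hτ Dt β ι hc hk hcK d⟩

end Summit.BirchSwinnertonDyer.Rank1Residual.JET

end
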